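import Literature.MathematicalPhysics.QuantumFieldTheory.Balaban1983to89.B12QPrime348
import Literature.MathematicalPhysics.QuantumFieldTheory.Balaban1983to89.B7Prop5FlatOperator

/-!
# `Balaban1983to89.B12Ineq349Flat` — [Balaban1987RG1] (3.49) p. 279 HYPOTHESIS-FREE at the flat background: the printed
`|Q′| ≤ O(1)L^jη|𝐀| < O(1)α₂L^jη` for the concrete `Λ` of (3.30)/(3.48) and the concrete composite averaging `Q_k(1, ·)` of
[Balaban1985Averaging], with «Proposition 5 [7]» supplied in operator form — PROVED

HONEST FRAMING (cell `lit-balaban`, verbatim): statement-level skeleton of published theorems with citation tags; proofs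
where landed; nothing here is a claim about the Yang–Mills mass gap.

CITATION HEADER.  T. Bałaban, *Renormalization group approach to lattice gauge field theories. I*, Commun. Math. Phys.
**109** (1987) 249–301 [Balaban1987RG1] (cell paper B12 = [I]; journal page = PDF page + 248; (3.48)–(3.49) p. 279 read
on the render `b2b-balaban-ref1/pages/1987-cmp109-rg-I-small-field/…-p031-x2.png`, p. 285 on `…-p037-x2.png`);
T. Bałaban, *Averaging operations for lattice gauge theories*, Commun. Math. Phys. **98** (1985) 17–51 [Balaban1985Averaging]
(= [7] of [I]; Prop. 5 (156) p. 42).  Unit `lit-balaban-r20` gen 3 (fold owner of B12); rows B12.Eq3.48-3.49 (supplement: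
the δQ/δA input discharged) — the assembly of `B12QPrime348` (r20 p243393: (3.48), (3.49) with the operator input as a
hypothesis, `‖δΛ/δ𝐀‖ ≤ 11/8` proved) and `B7Prop5FlatOperator` (r20 p244593: Prop. 5 [7] at `U₀ = 1` in operator form,
`‖D Q_k(1, ·)‖_{sup→sup} ≤ 2dL^k(1 + C₃L^kb)`), all BY NAME.

WHAT IS PRINTED (verbatim).  [I] p. 279: *«The function Q′ satisfies the inequality |Q′| ≤ O(1)L^jη|𝐀| < O(1)α₂L^jη on □₀,
(3.49) with an absolute constant O(1).»*  [I] p. 285: *«More precisely, (3.32) and Proposition 5 [7] on functional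
derivatives of averaging operations imply (4.17)»* — the same input.  [7] p. 42, Proposition 5, (156): *«|(δ/δA_b)Q_k(U₀,
ηA, c)| ≤ 1 + 2C′₁α₀ + C₃|A| < 1 + 2C′₁α₀ + C₃α₁»*.

WHAT THIS FILE PROVES (kernel, 0 sorry, standard axioms; theorems only; v1 = p244703, v1.1 = + the section `Eq348Flat`).  `norm_smul_lam330_seg_le`: along the segment
`t𝐀`, `t ∈ [0,1]`, the argument `ηΛ(t𝐀, h)` of `Q` stays in the closed polydisc of radius `b` as soon as
`(11/8)η(|𝐀(s)| + |h(s)|) ≤ b` bondwise (`B12Membership313II.norm_newPot_le`); **`ineq349_flat`**: for `L ≥ 2`, finite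
sets `S` (fine bonds) and `T` (coarse bonds), `Q = B7Prop5FlatOperator.avgMap L S T k` (`= Q_k(1, ·)` on `𝔸^S → 𝔸^T`),
`𝐀 ∈ small330 η h`, `(11/8)η(|𝐀| + |h|) ≤ b`, `C₃(d, L)·L^k·b ≤ 1`:
`|Q′| ≤ ((11/4)d(1 + C₃L^kb))·L^kη|𝐀|` and `< (…)·α₂L^kη` when `|𝐀| < α₂` — (3.49) with `O(1) = (11/4)d(1 + C₃L^kb) ≤
(11/2)d`, via `B12QPrime348.ineq349_printed` fed with `B7Prop5FlatOperator.opNorm_fderiv_real_avgMap_le` and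
`B12QPrime348.norm_fderiv_lam330_le`.  v1.1 (same seat): `norm_smul_lam330_le`, `contDiffOn_avgMap_polydisc` (`Q_k(1, ·)` is `C¹`
over `ℝ` on the open polydisc, from `B7Prop5FlatOperator.analyticAt_avgMap_apply`), **`eq348_flat`**: the first line of (3.48)
itself, «B = Q(ηA) = Q(L⁻¹η𝐇_{k+1}) + Q′», HYPOTHESIS-FREE for the same concrete `Q`, `Λ` (`B12QPrime348.eq348_printed` on the
star-shaped open set `small330 ∩ {(11/8)η(|x| + |h|) < b}`, mapped by `ηΛ` into the polydisc; `Λ(0, h) = h` by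
`lam330_zero_of_mem`).

DIVERGENCES / SCOPE (recorded, not asserted).  Flat background `U₀ = 1` only (the curved-background Prop. 5, leaf
`B7.Prop5Printed`, is neither used nor claimed); `ℤ^d` fine lattice with finitely many live bond variables `S` (the others
frozen at `0`), finitely many coarse bonds `T`; `B`-variables of [7] (the `L^k` is the scale of the argument `ηΛ`, [7] (150));
the field-level `Λ` is `B12QPrime348.lam330` (bondwise `newPot`), so `Q′` here is the printed `Q′` of (3.48) for THESE
concrete objects; «on □₀» (domains) is not modelled beyond the finite index sets.  Why not `ineq349_lam330`: its hypothesis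
`hmaps` ranges over all of `small330 η h`, where `‖ηΛ‖` reaches `11/64`, incompatible with `C₃L^kb ≤ 1`; the segment form
`ineq349_printed` needs the operator bound only along `ηΛ(t𝐀)`, `t ∈ [0,1]`.
-/

namespace Literature.MathematicalPhysics.QuantumFieldTheory.Balaban1983to89.B12Ineq349Flat

open Set
open Literature.MathematicalPhysics.QuantumFieldTheory.Balaban1983to89
open Literature.MathematicalPhysics.QuantumFieldTheory.Balaban1983to89.B12QPrime348 (qPrime lam330 small330
  smul_mem_small330 norm_fderiv_lam330_le ineq349_printed lam330_apply)
open Literature.MathematicalPhysics.QuantumFieldTheory.Balaban1983to89.B12Membership313II (newPot norm_newPot_le)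
open Literature.MathematicalPhysics.QuantumFieldTheory.Balaban1983to89.B7Prop5FlatOperator (avgMap
  opNorm_fderiv_real_avgMap_le)
open Literature.MathematicalPhysics.QuantumFieldTheory.Balaban1983to89.B7Prop5Flat (C3)

variable {d : ℕ} {𝔸 : Type*} [NormedRing 𝔸] [NormedAlgebra ℂ 𝔸] [CompleteSpace 𝔸]

/-- Size of the argument `ηΛ(t𝐀, h)` along the segment: if `𝐀 ∈ small330 η h` and `(11/8)η(|𝐀(s)| + |h(s)|) ≤ b` for every
bond, then `‖ηΛ(t𝐀, h)(s)‖ ≤ b` for `t ∈ [0,1]` (`‖Λ(X, Y)‖ ≤ ‖X‖ + ‖Y‖ + 3η(‖X‖ + ‖Y‖)² ≤ (11/8)(‖X‖ + ‖Y‖)` on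
`η(‖X‖ + ‖Y‖) ≤ 1/8`, `B12Membership313II.norm_newPot_le` BY NAME). [cite: Balaban1987RG1, (3.32) p.277, (3.48) p.279]
(elementary API; our proof) -/
theorem norm_smul_lam330_seg_le {S : Finset (B7Prop1Explicit.Site d × Fin d)} {η b : ℝ} (hη : 0 < η) {h A : S → 𝔸}
    (hA : A ∈ small330 η h) (hAb : ∀ s, 11 / 8 * (η * (‖A s‖ + ‖h s‖)) ≤ b) {t : ℝ} (ht : t ∈ Icc (0 : ℝ) 1)
    (s : S) : ‖(η • lam330 η h (t • A)) s‖ ≤ b := by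
  have htA : ‖(t • A) s‖ ≤ ‖A s‖ := by
    rw [Pi.smul_apply, norm_smul, Real.norm_eq_abs, abs_of_nonneg ht.1]
    exact mul_le_of_le_one_left (norm_nonneg _) ht.2
  have hsm : η * (‖(t • A) s‖ + ‖h s‖) < 1 / 8 := smul_mem_small330 hη.le hA ht s
  have h1 := norm_newPot_le hη hsm.le
  have hsum : 0 ≤ ‖(t • A) s‖ + ‖h s‖ := by positivity
  have h2 : 3 * η * (‖(t • A) s‖ + ‖h s‖) ^ 2 ≤ 3 / 8 * (‖(t • A) s‖ + ‖h s‖) := by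
    nlinarith [mul_le_mul_of_nonneg_left hsm.le hsum]
  rw [Pi.smul_apply, lam330_apply, norm_smul, Real.norm_eq_abs, abs_of_pos hη]
  have h3 : ‖newPot η ((t • A) s) (h s)‖ ≤ 11 / 8 * (‖A s‖ + ‖h s‖) := by
    have h0 : 0 ≤ ‖h s‖ := norm_nonneg _
    linarith
  calc η * ‖newPot η ((t • A) s) (h s)‖ ≤ η * (11 / 8 * (‖A s‖ + ‖h s‖)) :=
        mul_le_mul_of_nonneg_left h3 hη.le
    _ = 11 / 8 * (η * (‖A s‖ + ‖h s‖)) := by ring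
    _ ≤ b := hAb s

/-- **(3.49) AT THE FLAT BACKGROUND, HYPOTHESIS-FREE**: for the concrete `Λ(·, h)` of (3.30)/(3.48) (`lam330 η h`) and the
concrete composite averaging `Q = Q_k(1, ·)` of [7] on the finite products `𝔸^S → 𝔸^T` (`B7Prop5FlatOperator.avgMap L S T
k`, `L ≥ 2`), if `𝐀 ∈ small330 η h`, `(11/8)η(|𝐀(s)| + |h(s)|) ≤ b` on every bond and `C₃(d, L)·L^k·b ≤ 1` (the smallness
of Prop. 5 [7] for the argument `ηΛ`), then
`|Q′| ≤ (2d(1 + C₃L^kb)·(11/8))·L^kη|𝐀|`, and `< (…)·α₂L^kη` when `|𝐀| < α₂` (and the constant is positive) — the printed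
«|Q′| ≤ O(1)L^jη|𝐀| < O(1)α₂L^jη» with `O(1) = (11/4)d(1 + C₃L^kb) ≤ (11/2)d`, the inputs being Proposition 5 [7] in
operator form (`opNorm_fderiv_real_avgMap_le`) and `‖δΛ/δ𝐀‖ ≤ 11/8` (`norm_fderiv_lam330_le`), fed to `ineq349_printed`
(all BY NAME). [cite: Balaban1987RG1, (3.49) p.279, p.285 (before (4.17)); Balaban1985Averaging, Prop. 5 (156) p.42] -/
theorem ineq349_flat (L : ℕ) (hL : 2 ≤ L) (S T : Finset (B7Prop1Explicit.Site d × Fin d)) (k : ℕ) {η b α₂ : ℝ}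
    (hη : 0 < η) (hb : 0 ≤ b) (hk : C3 d L * ((L : ℝ) ^ k * b) ≤ 1) {h A : S → 𝔸} (hA : A ∈ small330 η h)
    (hAb : ∀ s, 11 / 8 * (η * (‖A s‖ + ‖h s‖)) ≤ b) :
    ‖qPrime (avgMap L S T k) (lam330 η h) η A‖ ≤
        (2 * d * (1 + C3 d L * ((L : ℝ) ^ k * b)) * (11 / 8)) * (L : ℝ) ^ k * η * ‖A‖ ∧
      (‖A‖ < α₂ → 0 < 2 * d * (1 + C3 d L * ((L : ℝ) ^ k * b)) * (11 / 8) * (L : ℝ) ^ k * η →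
        ‖qPrime (avgMap L S T k) (lam330 η h) η A‖ <
          (2 * d * (1 + C3 d L * ((L : ℝ) ^ k * b)) * (11 / 8)) * α₂ * (L : ℝ) ^ k * η) := by
  refine ineq349_printed (C₁ := 2 * d * (1 + C3 d L * ((L : ℝ) ^ k * b))) (C₂ := 11 / 8) (L := (L : ℝ)) (j := k)
    hη.le (fun t ht => ?_) (fun t ht => norm_fderiv_lam330_le hη (smul_mem_small330 hη.le hA ht))
  calc ‖fderiv ℝ (avgMap L S T k) (η • lam330 η h (t • A))‖
      ≤ 2 * d * (L : ℝ) ^ k * (1 + C3 d L * ((L : ℝ) ^ k * b)) :=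
        opNorm_fderiv_real_avgMap_le L hL S T k hb hk (fun s => norm_smul_lam330_seg_le hη hA hAb ht s)
    _ = 2 * d * (1 + C3 d L * ((L : ℝ) ^ k * b)) * (L : ℝ) ^ k := by ring

/-! ## v1.1  (3.48) itself, hypothesis-free at the flat background: `B = Q(ηΛ(𝐀)) = Q(ηh) + Q′` for `Q = Q_k(1, ·)` -/

section Eq348Flat

open Literature.MathematicalPhysics.QuantumFieldTheory.Balaban1983to89.B12QPrime348 (isOpen_small330 contDiffOn_lam330
  lam330_zero_of_mem eq348_printed)
open Literature.MathematicalPhysics.QuantumFieldTheory.Balaban1983to89.B7Prop5FlatOperator (analyticAt_avgMap_apply)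
open Literature.MathematicalPhysics.QuantumFieldTheory.Balaban1983to89.B7Prop4Flat (isOpen_polydisc)

/-- Size of `ηΛ(x, h)` on `small330`: `‖ηΛ(x, h)(s)‖ ≤ (11/8)η(‖x(s)‖ + ‖h(s)‖)` (`B12Membership313II.norm_newPot_le` BY
NAME). [cite: Balaban1987RG1, (3.32) p.277, (3.48) p.279] (elementary API; our proof) -/
theorem norm_smul_lam330_le {S : Finset (B7Prop1Explicit.Site d × Fin d)} {η : ℝ} (hη : 0 < η) {h x : S → 𝔸}
    (hx : x ∈ small330 η h) (s : S) : ‖(η • lam330 η h x) s‖ ≤ 11 / 8 * (η * (‖x s‖ + ‖h s‖)) := by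
  have hsm : η * (‖x s‖ + ‖h s‖) < 1 / 8 := hx s
  have h1 := norm_newPot_le hη hsm.le
  have hsum : 0 ≤ ‖x s‖ + ‖h s‖ := by positivity
  have h2 : 3 * η * (‖x s‖ + ‖h s‖) ^ 2 ≤ 3 / 8 * (‖x s‖ + ‖h s‖) := by
    nlinarith [mul_le_mul_of_nonneg_left hsm.le hsum]
  rw [Pi.smul_apply, lam330_apply, norm_smul, Real.norm_eq_abs, abs_of_pos hη]
  have h3 : ‖newPot η (x s) (h s)‖ ≤ 11 / 8 * (‖x s‖ + ‖h s‖) := by linarith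
  calc η * ‖newPot η (x s) (h s)‖ ≤ η * (11 / 8 * (‖x s‖ + ‖h s‖)) := mul_le_mul_of_nonneg_left h3 hη.le
    _ = 11 / 8 * (η * (‖x s‖ + ‖h s‖)) := by ring

/-- `Q_k(1, ·)` is of class `C¹` over `ℝ` on the open polydisc `{∀ s, ‖y s‖ < b}` when `C₃L^kb ≤ 1` (componentwise analytic:
`B7Prop5FlatOperator.analyticAt_avgMap_apply`, BY NAME). [cite: Balaban1985Averaging, Prop. 4 p.38] (elementary API;
our proof) -/
theorem contDiffOn_avgMap_polydisc (L : ℕ) (hL : 2 ≤ L) (S T : Finset (B7Prop1Explicit.Site d × Fin d)) (k : ℕ)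
    {b : ℝ} (hb : 0 ≤ b) (hk : C3 d L * ((L : ℝ) ^ k * b) ≤ 1) :
    ContDiffOn ℝ 1 (avgMap L S T k) {y : S → 𝔸 | ∀ s, ‖y s‖ < b} :=
  contDiffOn_pi' fun c => fun _ hy =>
    (((analyticAt_avgMap_apply L hL S T k hb hk (fun s => (hy s).le) c).contDiffAt (n := 1)).restrict_scalars
      ℝ).contDiffWithinAt

/-- **(3.48) AT THE FLAT BACKGROUND, HYPOTHESIS-FREE**: «B = Q(ηA) = Q(L⁻¹η𝐇_{k+1}) + Q′» for the concrete `Λ` of (3.30)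
(`lam330 η h`, `A = Λ(𝐀, h)`, `h = L⁻¹𝐇_{k+1}`) and the concrete composite averaging `Q = Q_k(1, ·)` of [7] on finite
products (`avgMap L S T k`, `L ≥ 2`): if `𝐀 ∈ small330 η h`, `(11/8)η(|𝐀(s)| + |h(s)|) < b` on every bond and `C₃(d, L)·L^k·b
≤ 1`, then `Q(ηΛ(𝐀, h)) = Q(ηh) + Q′` with the printed integral `Q′ = qPrime Q Λ η 𝐀` — `B12QPrime348.eq348_printed` (BY
NAME) on the star-shaped open set `small330 ∩ {(11/8)η(|x| + |h|) < b}`, which `ηΛ` maps into the polydisc where `Q` is `C¹`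
(`contDiffOn_avgMap_polydisc`); `Λ(0, h) = h` is `lam330_zero_of_mem`. [cite: Balaban1987RG1, (3.48) p.279; Balaban1985Averaging, Prop. 4 p.38] -/
theorem eq348_flat (L : ℕ) (hL : 2 ≤ L) (S T : Finset (B7Prop1Explicit.Site d × Fin d)) (k : ℕ) {η b : ℝ} (hη : 0 < η)
    (hb : 0 ≤ b) (hk : C3 d L * ((L : ℝ) ^ k * b) ≤ 1) {h A : S → 𝔸} (hA : A ∈ small330 η h)
    (hAb : ∀ s, 11 / 8 * (η * (‖A s‖ + ‖h s‖)) < b) :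
    avgMap L S T k (η • lam330 η h A) = avgMap L S T k (η • h) + qPrime (avgMap L S T k) (lam330 η h) η A := by
  -- the star-shaped open domain of `𝐀`'s and the polydisc of arguments of `Q`
  set s₀ : Set (S → 𝔸) := small330 η h ∩ {x | ∀ s, 11 / 8 * (η * (‖x s‖ + ‖h s‖)) < b} with hs₀
  have hopen' : IsOpen {x : S → 𝔸 | ∀ s, 11 / 8 * (η * (‖x s‖ + ‖h s‖)) < b} := by
    rw [Set.setOf_forall]
    exact isOpen_iInter_of_finite fun s => isOpen_lt (by fun_prop) continuous_const
  have hs₀o : IsOpen s₀ := (isOpen_small330 η h).inter hopen'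
  have hseg : ∀ t ∈ Icc (0 : ℝ) 1, t • A ∈ s₀ := by
    intro t ht
    refine ⟨smul_mem_small330 hη.le hA ht, fun s => ?_⟩
    have htA : ‖(t • A) s‖ ≤ ‖A s‖ := by
      rw [Pi.smul_apply, norm_smul, Real.norm_eq_abs, abs_of_nonneg ht.1]
      exact mul_le_of_le_one_left (norm_nonneg _) ht.2
    have h0 : 0 ≤ ‖h s‖ := norm_nonneg _
    calc 11 / 8 * (η * (‖(t • A) s‖ + ‖h s‖)) ≤ 11 / 8 * (η * (‖A s‖ + ‖h s‖)) := by gcongr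
      _ < b := hAb s
  have hmaps : ∀ x ∈ s₀, η • lam330 η h x ∈ {y : S → 𝔸 | ∀ s, ‖y s‖ < b} := fun x hx s =>
    (norm_smul_lam330_le hη hx.1 s).trans_lt (hx.2 s)
  exact eq348_printed hs₀o (isOpen_polydisc S b) ((contDiffOn_lam330 hη.le h).mono Set.inter_subset_left)
    (contDiffOn_avgMap_polydisc L hL S T k hb hk) η A h (lam330_zero_of_mem hη hA) hseg hmaps

end Eq348Flat

end Literature.MathematicalPhysics.QuantumFieldTheory.Balaban1983to89.B12Ineq349Flat
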